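import Literature.MathematicalPhysics.QuantumFieldTheory.ConformalBootstrap3D.ZSeriesBlockCoefficients
import Mathlib.Algebra.Order.BigOperators.Group.Finset
import Mathlib.Analysis.SpecialFunctions.Pow.Real
import Mathlib.Tactic.FieldSimp
import Mathlib.Tactic.Linarith
import Mathlib.Tactic.Ring
import Mathlib.Tactic.Positivity
import HarnessLib

/-!
# The Dolan–Osborn `z`-series recursion for 3D blocks with unequal external dimensions

Dolan–Osborn, *Conformal partial waves and the operator product expansion*, Nucl. Phys. B 678
(2004) 491 [hep-th/0309180], §3 "Solution in terms of Jack polynomials": for GENERAL external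
dimensions, `a = -Δ₁₂/2`, `b = Δ₃₄/2` (their eq. (2.4)), and general `d = ε + 2`, the solution of
the quadratic Casimir equation `2 D_ε F = C_{Δ,ℓ} F` (their (2.2)–(2.3); the operator `D_ε` is the
tree's `dolanOsbornD` pair plus the `ε`-term, i.e. `CasimirEq3D` at `ε = 1`) with the boundary
behaviour `F → x^{λ₁} z^{λ₂}` (their (2.5), `λ₁ = (Δ+ℓ)/2`, `λ₂ = (Δ-ℓ)/2`) is the series
`F = Σ_{m,n ≥ 0} r_{mn} P_{λ₁+m, λ₂+n}(x,z)` (their (3.10)) in the two-variable Jack polynomials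
`P_{λ₁λ₂}(x,z) = (xz)^{(λ₁+λ₂)/2} C^{ε/2}_{λ₁-λ₂}(σ)/C^{ε/2}_{λ₁-λ₂}(1)`, `σ = (x+z)/(2√(xz))`
(their (3.5)) — which at `d = 3` are exactly the Hogervorst–Rychkov Gegenbauer blocks
`𝒫_{E,j} = s^E P_j(cos θ)` with `E = Δ + m + n`, `j = ℓ + m - n` — and

  `r_{mn} = (λ₁+a)_m (λ₁+b)_m (λ₂-ε/2+a)_n (λ₂-ε/2+b)_n r̂_{mn}`      (their (3.11)),

with `r̂_{mn}` determined by the `(a,b)`-INDEPENDENT recurrence (their (3.12))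
`(m(2λ₁-1+m) + n(2λ₂-2+n)) r̂_{mn} = [(λ₋+m-n-1+ε)/(λ₋+m-n-1+ε/2)] r̂_{m-1,n}
  + [(λ₋+m-n+1)/(λ₋+m-n+1+ε/2)] r̂_{m,n-1}` (`λ₋ = ℓ`; closed form their (3.19), proved in their
Appendix A). Combining (3.9)–(3.12): in the Hogervorst–Rychkov normalisation of
`ZSeriesBlockCoefficients` (`A_{0,ℓ} = 1`, pivot `casimirPivot3D` = twice the Dolan–Osborn pivot)
the coefficients `A_{n,j}(a,b)` of `g^{Δ₁₂,Δ₃₄}_{Δ,ℓ} = Σ A_{n,j} 𝒫_{Δ+n,j}` obey the SAME two-term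
recursion as Hogervorst–Rychkov eq. (3.9) with

  `γ⁺_{E,j}(a,b) = (E+j+2a)(E+j+2b)(j+1)/(2j+1)`,  `γ⁻_{E,j}(a,b) = (E-j-1+2a)(E-j-1+2b) j/(2j+1)`

(`a = b = 0`: `(E+j)²(j+1)/(2j+1)` and `(E-j-1)² j/(2j+1)`, Hogervorst–Rychkov eq. (3.8) at
`ν = 1/2` — `hrGammaPlus`, `hrGammaMinus`). NB: in the arXiv TeX of Dolan–Osborn eq. (3.9) the
factors are printed as `(λ₋+a)(λ₋+b)` and `(λ₋-ε/2+a)(λ₋-ε/2+b)`; re-deriving (3.9) from their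
(3.2) and (3.8) gives `(λ₁+a)(λ₁+b)` and `(λ₂-ε/2+a)(λ₂-ε/2+b)`, which is what their (3.11) uses and
what is transcribed here (checked: pub-ising3d `code/check_do2004_ab_recursion.py` compares this
recursion, the factorised form (3.11)–(3.12), the referee's direct exact solver of the typed monomial
Casimir system `SatisfiesCoeffCasimir`/`CasimirEq3D` with `a, b ≠ 0`, and the collinear `₂F₁` of
their (3.14): 11 parameter sets, levels `≤ 6`, 0 mismatches).

This file transcribes the general-`(a,b)` recursion at `d = 3` as `hrCoeffAB a b Δ ℓ n j` and PROVES: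

* `hrCoeffAB_zero_zero` — `a = b = 0` is `hrCoeff` (Hogervorst–Rychkov);
* `hrCoeffAB_support` — support on the descendant range `|j-ℓ| ≤ n`, `j ≡ ℓ+n (mod 2)`;
* `hrCoeffAB_self_nonneg` — for `a = b` (the reflection-positive ordering `⟨φ₁φ₂φ₂φ₁⟩`, e.g. the
  block family `g^{-Δ_σε,Δ_σε}` of `⟨εσσε⟩`) every coefficient is `≥ 0` strictly above the unitarity
  bound: the recursion is then MANIFESTLY non-negative, `γ^±(a,a)` being squares times positive
  rationals (Costa–Hansen–Penedones–Trevisani, JHEP 07 (2016) 057, §2.1: "if 𝒪₄ = 𝒪₁ and 𝒪₃ = 𝒪₂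
  then unitarity implies that all coefficients are non-negative"; here a theorem about the recursion);
* `hrCoeffAB_one_succ`, `hrCoeffAB_one_pred` — the level-one values
  `A_{1,ℓ+1} = (Δ+ℓ+2a)(Δ+ℓ+2b)(ℓ+1)/(2(2ℓ+1)(Δ+ℓ))`, `A_{1,ℓ-1} = (Δ-ℓ-1+2a)(Δ-ℓ-1+2b)ℓ/(2(2ℓ+1)(Δ-ℓ-1))`
  (transcription checks against the collinear `₂F₁(λ₁+a, λ₁+b; 2λ₁; z)` of Dolan–Osborn (3.14));
* `hrCoeffAB_mul_doPochFactor` — **the Dolan–Osborn factorisation (3.11)**: with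
  `m = (n+j-ℓ)/2`, `n' = (n+ℓ-j)/2` and `Π_{ab} = ∏_{i<m} (λ₁+i+a)(λ₁+i+b) · ∏_{i<n'} (λ₂-½+i+a)(λ₂-½+i+b)`,
  `A_{n,j}(a,b) · Π_{00} = Π_{ab} · A_{n,j}(0,0)` for all `n, j` (all `(Δ₁₂, Δ₃₄)`-dependence of the
  `z`-series coefficients sits in four Pochhammer symbols; in particular it is POLYNOMIAL in
  `(Δ₁₂, Δ₃₄)`, which is what a box-uniform certificate in `Δ_σε = Δ_σ - Δ_ε` needs);
* `hrCoeffAB_neg_mul_self` — consequence for the `a = -b` family (`g^{Δ_σε,Δ_σε}` of `⟨σεσε⟩`, not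
  sign-definite): `A_{n,j}(a,-a)² Π_{00}² = (A_{n,j}(a,a) Π_{00}) (A_{n,j}(-a,-a) Π_{00})`, whence,
  wherever `Π_{00} ≠ 0` (all `Δ` above the bound except `Δ = 1, ℓ = 0`), `A(a,-a)² = A(a,a) A(-a,-a)`
  and the termwise domination `|A_{n,j}(a,-a)| ≤ (A_{n,j}(a,a) + A_{n,j}(-a,-a))/2`
  (`abs_hrCoeffAB_neg_le`) — the coefficient-level form of the Cauchy–Schwarz bound of a
  non-reflection-positive ordering by the two reflection-positive ones.

What is NOT here: that these numbers are the expansion coefficients of the typed block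
`IsConformalBlock3D Δ₁₂ Δ₃₄ Δ ℓ` for `(Δ₁₂, Δ₃₄) ≠ (0,0)` (the `(a,b)`-analogue of
`BlockCoefficientExistence.hrMonomialCoeff_satisfies`, i.e. Dolan–Osborn (3.9) as an identity of
Legendre monomial arrays — not formalised; the exact cross-check against the typed system is the
script cited above), convergence, and the `ρ`-series. [cite: DolanOsborn2004, §3 eqs. (3.8)–(3.14)]
-/

namespace Literature.MathematicalPhysics.QuantumFieldTheory.ConformalBootstrap3D

open Finset

/-! ### The `(a,b)`-dependent recursion weights -/

/-- `γ⁺_{E,j}(a,b) = (E+j+2a)(E+j+2b)(j+1)/(2j+1)`: Dolan–Osborn 2004 eq. (3.9)/(3.11) first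
coefficient `[(λ₋+ε)/(λ₋+ε/2)](λ₁+a)(λ₁+b)` at `ε = 1`, `λ₁ = (E+j)/2`, times `2` (Hogervorst–Rychkov
pivot normalisation). [cite: DolanOsborn2004, §3 eqs. (3.9), (3.11)] -/
noncomputable def hrGammaPlusAB (a b E : ℝ) (j : ℕ) : ℝ :=
  (E + (j : ℝ) + 2 * a) * (E + (j : ℝ) + 2 * b) * ((j : ℝ) + 1) / (2 * (j : ℝ) + 1)

/-- `γ⁻_{E,j}(a,b) = (E-j-1+2a)(E-j-1+2b) j/(2j+1)`: Dolan–Osborn 2004 eq. (3.9)/(3.11) second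
coefficient `[λ₋/(λ₋+ε/2)](λ₂-ε/2+a)(λ₂-ε/2+b)` at `ε = 1`, `λ₂ - 1/2 = (E-j-1)/2`, times `2`.
[cite: DolanOsborn2004, §3 eqs. (3.9), (3.11)] -/
noncomputable def hrGammaMinusAB (a b E : ℝ) (j : ℕ) : ℝ :=
  (E - (j : ℝ) - 1 + 2 * a) * (E - (j : ℝ) - 1 + 2 * b) * (j : ℝ) / (2 * (j : ℝ) + 1)

/-- At `a = b = 0` the weight is Hogervorst–Rychkov's `γ⁺`. [cite: HogervorstRychkov2013, §3 eq. (3.8)] -/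
@[simp] theorem hrGammaPlusAB_zero_zero (E : ℝ) (j : ℕ) :
    hrGammaPlusAB 0 0 E j = hrGammaPlus E j := by
  unfold hrGammaPlusAB hrGammaPlus
  ring

/-- At `a = b = 0` the weight is Hogervorst–Rychkov's `γ⁻`. [cite: HogervorstRychkov2013, §3 eq. (3.8)] -/
@[simp] theorem hrGammaMinusAB_zero_zero (E : ℝ) (j : ℕ) :
    hrGammaMinusAB 0 0 E j = hrGammaMinus E j := by
  unfold hrGammaMinusAB hrGammaMinus
  ring

/-- `γ⁻_{E,0}(a,b) = 0`. [cite: DolanOsborn2004, §3 eq. (3.8)] -/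
@[simp] theorem hrGammaMinusAB_zero (a b E : ℝ) : hrGammaMinusAB a b E 0 = 0 := by
  simp [hrGammaMinusAB]

/-- The weights are symmetric in `(a,b)`. [cite: DolanOsborn2004, §3 eq. (3.11)] -/
theorem hrGammaPlusAB_comm (a b E : ℝ) (j : ℕ) : hrGammaPlusAB a b E j = hrGammaPlusAB b a E j := by
  unfold hrGammaPlusAB; ring

/-- The weights are symmetric in `(a,b)`. [cite: DolanOsborn2004, §3 eq. (3.11)] -/
theorem hrGammaMinusAB_comm (a b E : ℝ) (j : ℕ) :
    hrGammaMinusAB a b E j = hrGammaMinusAB b a E j := by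
  unfold hrGammaMinusAB; ring

/-- For `a = b`, `γ⁺(a,a) = (E+j+2a)²(j+1)/(2j+1) ≥ 0`. [cite: DolanOsborn2004, §3 eq. (3.11)] -/
theorem hrGammaPlusAB_self_nonneg (a E : ℝ) (j : ℕ) : 0 ≤ hrGammaPlusAB a a E j := by
  unfold hrGammaPlusAB
  have h : (E + (j : ℝ) + 2 * a) * (E + (j : ℝ) + 2 * a) = (E + (j : ℝ) + 2 * a) ^ 2 := by ring
  rw [h]
  positivity

/-- For `a = b`, `γ⁻(a,a) = (E-j-1+2a)² j/(2j+1) ≥ 0`. [cite: DolanOsborn2004, §3 eq. (3.11)] -/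
theorem hrGammaMinusAB_self_nonneg (a E : ℝ) (j : ℕ) : 0 ≤ hrGammaMinusAB a a E j := by
  unfold hrGammaMinusAB
  have h : (E - (j : ℝ) - 1 + 2 * a) * (E - (j : ℝ) - 1 + 2 * a) = (E - (j : ℝ) - 1 + 2 * a) ^ 2 := by
    ring
  rw [h]
  positivity

/-! ### The coefficients `A_{n,j}(a,b)` -/

/-- **The `z`-series coefficients `A_{n,j}(a, b; Δ, ℓ)` at `d = 3`** of the block
`g^{Δ₁₂,Δ₃₄}_{Δ,ℓ} = Σ_{n,j} A_{n,j} 𝒫_{Δ+n,j}`, `a = -Δ₁₂/2`, `b = Δ₃₄/2`, defined by the Dolan–Osborn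
recursion in Hogervorst–Rychkov normalisation: `A_{0,j} = δ_{jℓ}` and
`A_{n+1,j} = (γ⁺_{Δ+n,j-1}(a,b) A_{n,j-1} + γ⁻_{Δ+n,j+1}(a,b) A_{n,j+1}) / (C_{Δ+n+1,j} - C_{Δ,ℓ})`
(the `γ⁺` term absent for `j = 0`; division convention `x/0 = 0` at a vanishing pivot, which does not
occur on the descendant range above the unitarity bound, `casimirPivot3D_pos`).
(Dolan–Osborn 2004, eqs. (3.9)–(3.12), `ε = 1`, `c = 0`.) [cite: DolanOsborn2004, §3 eqs. (3.9)–(3.12)] -/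
noncomputable def hrCoeffAB (a b Δ : ℝ) (ℓ : ℕ) : ℕ → ℕ → ℝ
  | 0, j => if j = ℓ then 1 else 0
  | n + 1, j =>
      ((if j = 0 then 0 else hrGammaPlusAB a b (Δ + n) (j - 1) * hrCoeffAB a b Δ ℓ n (j - 1)) +
          hrGammaMinusAB a b (Δ + n) (j + 1) * hrCoeffAB a b Δ ℓ n (j + 1)) /
        casimirPivot3D Δ ℓ (n + 1) j

/-- Initial condition `A_{0,ℓ} = 1`. [cite: DolanOsborn2004, §3 eq. (3.13)] -/
@[simp] theorem hrCoeffAB_zero_self (a b Δ : ℝ) (ℓ : ℕ) : hrCoeffAB a b Δ ℓ 0 ℓ = 1 := by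
  simp [hrCoeffAB]

/-- Initial condition `A_{0,j} = 0`, `j ≠ ℓ`. [cite: DolanOsborn2004, §3 eq. (3.13)] -/
theorem hrCoeffAB_zero_of_ne (a b Δ : ℝ) {ℓ j : ℕ} (h : j ≠ ℓ) : hrCoeffAB a b Δ ℓ 0 j = 0 := by
  simp [hrCoeffAB, h]

/-- The recursion step, unfolded. [cite: DolanOsborn2004, §3 eq. (3.12)] -/
theorem hrCoeffAB_succ (a b Δ : ℝ) (ℓ n j : ℕ) :
    hrCoeffAB a b Δ ℓ (n + 1) j =
      ((if j = 0 then 0 else hrGammaPlusAB a b (Δ + n) (j - 1) * hrCoeffAB a b Δ ℓ n (j - 1)) +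
          hrGammaMinusAB a b (Δ + n) (j + 1) * hrCoeffAB a b Δ ℓ n (j + 1)) /
        casimirPivot3D Δ ℓ (n + 1) j := by
  rfl

/-- **`a = b = 0` is Hogervorst–Rychkov.** The equal-dimension coefficients `hrCoeff` are the special
case `Δ₁₂ = Δ₃₄ = 0`. [cite: DolanOsborn2004, §3 eq. (3.11)] -/
theorem hrCoeffAB_zero_zero (Δ : ℝ) (ℓ : ℕ) : ∀ n j : ℕ, hrCoeffAB 0 0 Δ ℓ n j = hrCoeff Δ ℓ n j := by
  intro n
  induction n with
  | zero => intro j; simp [hrCoeffAB, hrCoeff]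
  | succ n ih =>
    intro j
    rw [hrCoeffAB_succ, hrCoeff_succ, hrGammaPlusAB_zero_zero, hrGammaMinusAB_zero_zero, ih, ih]

/-- **Support.** A non-zero coefficient lies on the descendant range `|j - ℓ| ≤ n`,
`j ≡ ℓ + n (mod 2)` (a non-zero `A_{n+1,j}` has a non-zero parent `A_{n,j∓1}`); every `Δ, a, b`.
[cite: DolanOsborn2004, §3 eq. (3.10)] -/
theorem hrCoeffAB_support (a b Δ : ℝ) (ℓ : ℕ) :
    ∀ n j : ℕ, hrCoeffAB a b Δ ℓ n j ≠ 0 → InDescendantRange ℓ n j := by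
  intro n
  induction n with
  | zero =>
    intro j hj
    by_cases h : j = ℓ
    · subst h
      exact ⟨by omega, by omega, by omega⟩
    · exact absurd (hrCoeffAB_zero_of_ne a b Δ h) hj
  | succ n ih =>
    intro j hj
    rw [hrCoeffAB_succ] at hj
    have hnum : (if j = 0 then 0 else hrGammaPlusAB a b (Δ + n) (j - 1) * hrCoeffAB a b Δ ℓ n (j - 1)) +
        hrGammaMinusAB a b (Δ + n) (j + 1) * hrCoeffAB a b Δ ℓ n (j + 1) ≠ 0 := by
      intro h0
      apply hj
      rw [h0, zero_div]
    by_cases hm : hrCoeffAB a b Δ ℓ n (j + 1) ≠ 0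
    · obtain ⟨h1, h2, h3⟩ := ih (j + 1) hm
      exact ⟨by omega, by omega, by omega⟩
    · have hm' : hrCoeffAB a b Δ ℓ n (j + 1) = 0 := not_ne_iff.mp hm
      rw [hm', mul_zero, add_zero] at hnum
      by_cases hj0 : j = 0
      · simp [hj0] at hnum
      · rw [if_neg hj0] at hnum
        have hp : hrCoeffAB a b Δ ℓ n (j - 1) ≠ 0 := by
          intro h0
          apply hnum
          rw [h0, mul_zero]
        obtain ⟨h1, h2, h3⟩ := ih (j - 1) hp
        exact ⟨by omega, by omega, by omega⟩

/-- Off the descendant range the coefficient vanishes. [cite: DolanOsborn2004, §3 eq. (3.10)] -/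
theorem hrCoeffAB_eq_zero_of_not_inDescendantRange (a b Δ : ℝ) {ℓ n j : ℕ}
    (h : ¬ InDescendantRange ℓ n j) : hrCoeffAB a b Δ ℓ n j = 0 := by
  by_contra hne
  exact h (hrCoeffAB_support a b Δ ℓ n j hne)

/-- **Non-negativity for `a = b`** (`Δ₃₄ = -Δ₁₂`, the ordering `⟨φ₁φ₂φ₂φ₁⟩`; e.g. `gpm = g^{-Δ_σε,Δ_σε}`
of the typed `⟨εσσε⟩` sum rules). Strictly above the 3D unitarity bound every `A_{n,j}(a,a) ≥ 0`, for
every real `a`: `γ^±(a,a) ≥ 0` and the pivots are positive on the descendant range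
(`casimirPivot3D_pos`); off the range the coefficient is `0`. (Costa–Hansen–Penedones–Trevisani 2016
§2.1 state the non-negativity as a consequence of unitarity; here it is manifest in the recursion.)
[cite: DolanOsborn2004, §3 eqs. (3.11)–(3.12)] -/
theorem hrCoeffAB_self_nonneg {Δ : ℝ} {ℓ : ℕ} (a : ℝ) (hΔ : unitarityBound3D ℓ < Δ) :
    ∀ n j : ℕ, 0 ≤ hrCoeffAB a a Δ ℓ n j := by
  intro n
  induction n with
  | zero =>
    intro j
    by_cases h : j = ℓ
    · subst h; simp
    · rw [hrCoeffAB_zero_of_ne a a Δ h]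
  | succ n ih =>
    intro j
    by_cases hr : InDescendantRange ℓ (n + 1) j
    · obtain ⟨h1, h2, h3⟩ := hr
      rw [hrCoeffAB_succ]
      apply div_nonneg
      · apply add_nonneg
        · split_ifs
          · exact le_rfl
          · exact mul_nonneg (hrGammaPlusAB_self_nonneg _ _ _) (ih _)
        · exact mul_nonneg (hrGammaMinusAB_self_nonneg _ _ _) (ih _)
      · exact (casimirPivot3D_pos hΔ (by omega) h1 h2 h3).le
    · rw [hrCoeffAB_eq_zero_of_not_inDescendantRange a a Δ hr]

/-- The recursion in multiplied-out form wherever the pivot is non-zero.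
[cite: DolanOsborn2004, §3 eq. (3.12)] -/
theorem hrCoeffAB_succ_rec {a b Δ : ℝ} {ℓ n j : ℕ} (hp : casimirPivot3D Δ ℓ (n + 1) j ≠ 0) :
    casimirPivot3D Δ ℓ (n + 1) j * hrCoeffAB a b Δ ℓ (n + 1) j =
      (if j = 0 then 0 else hrGammaPlusAB a b (Δ + n) (j - 1) * hrCoeffAB a b Δ ℓ n (j - 1)) +
        hrGammaMinusAB a b (Δ + n) (j + 1) * hrCoeffAB a b Δ ℓ n (j + 1) := by
  rw [hrCoeffAB_succ, mul_div_cancel₀ _ hp]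

/-- **Transcription check, level one, spin up**: for `Δ + ℓ ≠ 0`,
`A_{1,ℓ+1}(a,b) = (Δ+ℓ+2a)(Δ+ℓ+2b)(ℓ+1)/(2(2ℓ+1)(Δ+ℓ))`; with the Legendre top coefficients
`λ_{ℓ+1}/λ_ℓ = (2ℓ+1)/(2ℓ+2)` this is the coefficient `(λ₁+a)(λ₁+b)/(2λ₁)` of `z^{ℓ+1}` in the collinear
block `z^ℓ ₂F₁(λ₁+a, λ₁+b; 2λ₁; z)` (Dolan–Osborn 2004, eq. (3.14) with `c = 0`).
[cite: DolanOsborn2004, §3 eq. (3.14)] -/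
theorem hrCoeffAB_one_succ {a b Δ : ℝ} {ℓ : ℕ} (hΔℓ : Δ + (ℓ : ℝ) ≠ 0) :
    hrCoeffAB a b Δ ℓ 1 (ℓ + 1) =
      (Δ + ℓ + 2 * a) * (Δ + ℓ + 2 * b) * ((ℓ : ℝ) + 1) / (2 * (2 * (ℓ : ℝ) + 1) * (Δ + ℓ)) := by
  have hpiv : casimirPivot3D Δ ℓ 1 (ℓ + 1) = 2 * (Δ + (ℓ : ℝ)) := by
    unfold casimirPivot3D; push_cast; ring
  have hne : ℓ + 1 + 1 ≠ ℓ := by omega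
  change hrCoeffAB a b Δ ℓ (0 + 1) (ℓ + 1) = _
  rw [hrCoeffAB_succ]
  simp only [Nat.add_sub_cancel, hrCoeffAB_zero_self, hrCoeffAB_zero_of_ne a b Δ hne, mul_zero,
    add_zero, mul_one, Nat.cast_zero]
  rw [if_neg (by omega), hpiv]
  unfold hrGammaPlusAB
  have h2 : (2 : ℝ) * (ℓ : ℝ) + 1 ≠ 0 := by positivity
  have h3 : (2 : ℝ) * (2 * (ℓ : ℝ) + 1) * (Δ + ℓ) ≠ 0 := mul_ne_zero (by positivity) hΔℓ
  rw [div_div, div_eq_div_iff (mul_ne_zero h2 (mul_ne_zero two_ne_zero hΔℓ)) h3]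
  ring

/-- **Transcription check, level one, spin down**: for `ℓ ≥ 1` and `Δ ≠ ℓ + 1`,
`A_{1,ℓ-1}(a,b) = (Δ-ℓ-1+2a)(Δ-ℓ-1+2b) ℓ/(2(2ℓ+1)(Δ-ℓ-1))` (pivot `C_{Δ+1,ℓ-1} - C_{Δ,ℓ} = 2(Δ-ℓ-1)`);
at `a = b = 0` this is Hogervorst–Rychkov eq. (3.10), `(Δ-ℓ-2ν)ℓ/(4(ℓ+ν))` at `ν = 1/2`. For `ab ≠ 0`
it exhibits the pole of the unequal-dimension block at the unitarity bound `Δ = ℓ+1`.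
[cite: DolanOsborn2004, §3 eqs. (3.11)–(3.12)] -/
theorem hrCoeffAB_one_pred {a b Δ : ℝ} {ℓ : ℕ} (hℓ : 1 ≤ ℓ) (hΔ : Δ - (ℓ : ℝ) - 1 ≠ 0) :
    hrCoeffAB a b Δ ℓ 1 (ℓ - 1) =
      (Δ - ℓ - 1 + 2 * a) * (Δ - ℓ - 1 + 2 * b) * (ℓ : ℝ) / (2 * (2 * (ℓ : ℝ) + 1) * (Δ - ℓ - 1)) := by
  obtain ⟨k, rfl⟩ : ∃ k, ℓ = k + 1 := ⟨ℓ - 1, by omega⟩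
  have hpiv : casimirPivot3D Δ (k + 1) 1 k = 2 * (Δ - ((k + 1 : ℕ) : ℝ) - 1) := by
    unfold casimirPivot3D; push_cast; ring
  simp only [Nat.add_sub_cancel]
  change hrCoeffAB a b Δ (k + 1) (0 + 1) k = _
  rw [hrCoeffAB_succ]
  have hzero : (if k = 0 then (0 : ℝ)
      else hrGammaPlusAB a b (Δ + ((0 : ℕ) : ℝ)) (k - 1) * hrCoeffAB a b Δ (k + 1) 0 (k - 1)) = 0 := by
    split_ifs with hk
    · rfl
    · rw [hrCoeffAB_zero_of_ne a b Δ (by omega : k - 1 ≠ k + 1), mul_zero]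
  rw [hzero, zero_add, hrCoeffAB_zero_self, mul_one, Nat.cast_zero, add_zero, hpiv]
  unfold hrGammaMinusAB
  have h2 : (2 : ℝ) * (((k + 1 : ℕ) : ℝ)) + 1 ≠ 0 := by positivity
  have h3 : (2 : ℝ) * (2 * (((k + 1 : ℕ) : ℝ)) + 1) * (Δ - ((k + 1 : ℕ) : ℝ) - 1) ≠ 0 := by
    apply mul_ne_zero
    · positivity
    · exact hΔ
  rw [div_div, div_eq_div_iff (mul_ne_zero h2 (mul_ne_zero two_ne_zero hΔ)) h3]
  push_cast
  ring

/-- The diagonal level sums `a_n(a,b; Δ, ℓ) = Σ_j A_{n,j}(a,b)` (coefficient of `x^{Δ+n}` in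
`g^{Δ₁₂,Δ₃₄}(x,x)` once the coefficients are identified with the block's). [cite: DolanOsborn2004, §3 eq. (3.10)] -/
noncomputable def hrLevelSumAB (a b Δ : ℝ) (ℓ n : ℕ) : ℝ :=
  ∑ j ∈ Finset.range (ℓ + n + 1), hrCoeffAB a b Δ ℓ n j

/-- For `a = b` the level sums are non-negative above the bound. [cite: DolanOsborn2004, §3 eq. (3.11)] -/
theorem hrLevelSumAB_self_nonneg {Δ : ℝ} {ℓ : ℕ} (a : ℝ) (hΔ : unitarityBound3D ℓ < Δ) (n : ℕ) :
    0 ≤ hrLevelSumAB a a Δ ℓ n :=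
  Finset.sum_nonneg fun j _ => hrCoeffAB_self_nonneg a hΔ n j

/-- Coefficients beyond `j = ℓ + n` vanish. [cite: DolanOsborn2004, §3 eq. (3.10)] -/
theorem hrCoeffAB_eq_zero_of_lt (a b Δ : ℝ) {ℓ n j : ℕ} (h : ℓ + n < j) : hrCoeffAB a b Δ ℓ n j = 0 :=
  hrCoeffAB_eq_zero_of_not_inDescendantRange a b Δ (fun hr => by obtain ⟨_, h2, _⟩ := hr; omega)

/-! ### The Dolan–Osborn factorisation of the `(a,b)`-dependence (their eq. (3.11)) -/

/-- The Dolan–Osborn index `m = (n + j - ℓ)/2` of the coefficient `A_{n,j}` (number of `λ₁`-raising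
steps: `A_{n,j} = r_{m n'}` with `E = Δ + m + n'`, `j = ℓ + m - n'`); meaningful on the descendant
range. [cite: DolanOsborn2004, §3 eq. (3.10)] -/
def doIndexM (ℓ n j : ℕ) : ℕ := (n + j - ℓ) / 2

/-- The Dolan–Osborn index `n' = (n + ℓ - j)/2` of `A_{n,j}` (number of `λ₂`-raising steps).
[cite: DolanOsborn2004, §3 eq. (3.10)] -/
def doIndexN (ℓ n j : ℕ) : ℕ := (n + ℓ - j) / 2

/-- **The Pochhammer factor** `Π_{ab}(n,j) = (λ₁+a)_m (λ₁+b)_m (λ₂-½+a)_{n'} (λ₂-½+b)_{n'}` of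
Dolan–Osborn 2004 eq. (3.11) at `ε = 1` (`λ₁ = (Δ+ℓ)/2`, `λ₂ - ½ = (Δ-ℓ-1)/2`, `m = doIndexM`,
`n' = doIndexN`), written as finite products. [cite: DolanOsborn2004, §3 eq. (3.11)] -/
noncomputable def doPochFactor (a b Δ : ℝ) (ℓ n j : ℕ) : ℝ :=
  (∏ i ∈ Finset.range (doIndexM ℓ n j), ((Δ + ℓ) / 2 + i + a) * ((Δ + ℓ) / 2 + i + b)) *
    ∏ i ∈ Finset.range (doIndexN ℓ n j), ((Δ - ℓ - 1) / 2 + i + a) * ((Δ - ℓ - 1) / 2 + i + b)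

/-- At level zero, spin `ℓ`, both indices vanish and `Π = 1`. [cite: DolanOsborn2004, §3 eq. (3.11)] -/
theorem doPochFactor_zero_self (a b Δ : ℝ) (ℓ : ℕ) : doPochFactor a b Δ ℓ 0 ℓ = 1 := by
  unfold doPochFactor doIndexM doIndexN
  simp

/-- Index bookkeeping: a spin-raising step from an on-range parent raises `m` by one. [folklore] -/
private theorem doIndexM_succ_succ {ℓ n j : ℕ} (h : ℓ ≤ j + n) :
    doIndexM ℓ (n + 1) (j + 1) = doIndexM ℓ n j + 1 := by
  unfold doIndexM; omega

/-- Index bookkeeping: a spin-raising step keeps `n'`. [folklore] -/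
private theorem doIndexN_succ_succ (ℓ n j : ℕ) : doIndexN ℓ (n + 1) (j + 1) = doIndexN ℓ n j := by
  unfold doIndexN; omega

/-- On the descendant range `2m = n + j - ℓ` exactly. [folklore] -/
private theorem two_mul_doIndexM {ℓ n j : ℕ} (h : ℓ ≤ j + n) (hp : (j + ℓ + n) % 2 = 0) :
    2 * doIndexM ℓ n j = n + j - ℓ := by
  unfold doIndexM; omega

/-- Index bookkeeping: a spin-lowering step keeps `m`. [folklore] -/
private theorem doIndexM_succ_pred (ℓ n j : ℕ) : doIndexM ℓ (n + 1) j = doIndexM ℓ n (j + 1) := by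
  unfold doIndexM; omega

/-- Index bookkeeping: a spin-lowering step from an on-range parent raises `n'` by one. [folklore] -/
private theorem doIndexN_succ_pred {ℓ n j : ℕ} (h : j + 1 ≤ ℓ + n) :
    doIndexN ℓ (n + 1) j = doIndexN ℓ n (j + 1) + 1 := by
  unfold doIndexN; omega

/-- On the descendant range `2n' = n + ℓ - j` exactly. [folklore] -/
private theorem two_mul_doIndexN {ℓ n j : ℕ} (h : j ≤ ℓ + n) (hp : (j + ℓ + n) % 2 = 0) :
    2 * doIndexN ℓ n j = n + ℓ - j := by
  unfold doIndexN; omega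

/-- `Π(n+1, j+1) = Π(n, j) · (λ₁+m+a)(λ₁+m+b)` along a spin-raising step from an on-range parent.
[cite: DolanOsborn2004, §3 eq. (3.11)] -/
private theorem doPochFactor_succ_succ (a b Δ : ℝ) {ℓ n j : ℕ} (h : ℓ ≤ j + n) :
    doPochFactor a b Δ ℓ (n + 1) (j + 1) =
      doPochFactor a b Δ ℓ n j *
        (((Δ + ℓ) / 2 + (doIndexM ℓ n j : ℕ) + a) * ((Δ + ℓ) / 2 + (doIndexM ℓ n j : ℕ) + b)) := by
  unfold doPochFactor
  rw [doIndexM_succ_succ h, doIndexN_succ_succ, Finset.prod_range_succ]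
  ring

/-- `Π(n+1, j) = Π(n, j+1) · (λ₂-½+n'+a)(λ₂-½+n'+b)` along a spin-lowering step from an on-range
parent. [cite: DolanOsborn2004, §3 eq. (3.11)] -/
private theorem doPochFactor_succ_pred (a b Δ : ℝ) {ℓ n j : ℕ} (h : j + 1 ≤ ℓ + n) :
    doPochFactor a b Δ ℓ (n + 1) j =
      doPochFactor a b Δ ℓ n (j + 1) *
        (((Δ - ℓ - 1) / 2 + (doIndexN ℓ n (j + 1) : ℕ) + a) *
          ((Δ - ℓ - 1) / 2 + (doIndexN ℓ n (j + 1) : ℕ) + b)) := by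
  unfold doPochFactor
  rw [doIndexM_succ_pred, doIndexN_succ_pred h, Finset.prod_range_succ]
  ring

/-- `γ⁺_{E,j}(a,b) = 4(X+a)(X+b)(j+1)/(2j+1)` when `E + j = 2X` (`X = λ₁ + m`).
[cite: DolanOsborn2004, §3 eq. (3.9)] -/
private theorem hrGammaPlusAB_eq_of {a b E X : ℝ} {j : ℕ} (h : E + (j : ℝ) = 2 * X) :
    hrGammaPlusAB a b E j = 4 * ((X + a) * (X + b)) * ((j : ℝ) + 1) / (2 * (j : ℝ) + 1) := by
  unfold hrGammaPlusAB
  rw [h]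
  ring

/-- `γ⁻_{E,j}(a,b) = 4(Y+a)(Y+b) j/(2j+1)` when `E - j - 1 = 2Y` (`Y = λ₂ - ½ + n'`).
[cite: DolanOsborn2004, §3 eq. (3.9)] -/
private theorem hrGammaMinusAB_eq_of {a b E Y : ℝ} {j : ℕ} (h : E - (j : ℝ) - 1 = 2 * Y) :
    hrGammaMinusAB a b E j = 4 * ((Y + a) * (Y + b)) * (j : ℝ) / (2 * (j : ℝ) + 1) := by
  unfold hrGammaMinusAB
  rw [h]
  ring

/-- The spin-raising term of the inductive step of the factorisation. [cite: DolanOsborn2004, §3 eq. (3.11)] -/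
private theorem factor_step_plus (a b Δ : ℝ) (ℓ n j : ℕ)
    (ih : hrCoeffAB a b Δ ℓ n j * doPochFactor 0 0 Δ ℓ n j = doPochFactor a b Δ ℓ n j * hrCoeff Δ ℓ n j) :
    hrGammaPlusAB a b (Δ + n) j * hrCoeffAB a b Δ ℓ n j * doPochFactor 0 0 Δ ℓ (n + 1) (j + 1) =
      doPochFactor a b Δ ℓ (n + 1) (j + 1) * (hrGammaPlus (Δ + n) j * hrCoeff Δ ℓ n j) := by
  by_cases hr : InDescendantRange ℓ n j
  · obtain ⟨h1, h2, h3⟩ := hr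
    have hM := two_mul_doIndexM h1 h3
    set M := doIndexM ℓ n j with hMdef
    have hX : Δ + (n : ℝ) + (j : ℝ) = 2 * ((Δ + ℓ) / 2 + (M : ℝ)) := by
      have : ((2 * M : ℕ) : ℝ) = ((n + j - ℓ : ℕ) : ℝ) := by rw [hM]
      push_cast [Nat.cast_sub (by omega : ℓ ≤ n + j)] at this
      linarith
    rw [doPochFactor_succ_succ 0 0 Δ h1, doPochFactor_succ_succ a b Δ h1, hrGammaPlusAB_eq_of hX,
      ← hrGammaPlusAB_zero_zero, hrGammaPlusAB_eq_of hX]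
    rw [← hMdef]
    linear_combination (4 * (((Δ + ℓ) / 2 + (M : ℝ) + a) * ((Δ + ℓ) / 2 + (M : ℝ) + b)) *
      ((j : ℝ) + 1) / (2 * (j : ℝ) + 1)) *
      (((Δ + ℓ) / 2 + (M : ℝ) + 0) * ((Δ + ℓ) / 2 + (M : ℝ) + 0)) * ih
  · rw [hrCoeffAB_eq_zero_of_not_inDescendantRange a b Δ hr,
      hrCoeff_eq_zero_of_not_inDescendantRange Δ hr]
    ring

/-- The spin-lowering term of the inductive step of the factorisation. [cite: DolanOsborn2004, §3 eq. (3.11)] -/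
private theorem factor_step_minus (a b Δ : ℝ) (ℓ n j : ℕ)
    (ih : hrCoeffAB a b Δ ℓ n (j + 1) * doPochFactor 0 0 Δ ℓ n (j + 1) =
      doPochFactor a b Δ ℓ n (j + 1) * hrCoeff Δ ℓ n (j + 1)) :
    hrGammaMinusAB a b (Δ + n) (j + 1) * hrCoeffAB a b Δ ℓ n (j + 1) * doPochFactor 0 0 Δ ℓ (n + 1) j =
      doPochFactor a b Δ ℓ (n + 1) j * (hrGammaMinus (Δ + n) (j + 1) * hrCoeff Δ ℓ n (j + 1)) := by
  by_cases hr : InDescendantRange ℓ n (j + 1)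
  · obtain ⟨h1, h2, h3⟩ := hr
    have hN := two_mul_doIndexN h2 h3
    set N := doIndexN ℓ n (j + 1) with hNdef
    have hY : Δ + (n : ℝ) - ((j + 1 : ℕ) : ℝ) - 1 = 2 * ((Δ - ℓ - 1) / 2 + (N : ℝ)) := by
      have : ((2 * N : ℕ) : ℝ) = ((n + ℓ - (j + 1) : ℕ) : ℝ) := by rw [hN]
      push_cast [Nat.cast_sub (by omega : j + 1 ≤ n + ℓ)] at this ⊢
      linarith
    rw [doPochFactor_succ_pred 0 0 Δ h2, doPochFactor_succ_pred a b Δ h2, hrGammaMinusAB_eq_of hY,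
      ← hrGammaMinusAB_zero_zero, hrGammaMinusAB_eq_of hY]
    rw [← hNdef]
    linear_combination (4 * (((Δ - ℓ - 1) / 2 + (N : ℝ) + a) * ((Δ - ℓ - 1) / 2 + (N : ℝ) + b)) *
      (((j + 1 : ℕ) : ℝ)) / (2 * ((j + 1 : ℕ) : ℝ) + 1)) *
      (((Δ - ℓ - 1) / 2 + (N : ℝ) + 0) * ((Δ - ℓ - 1) / 2 + (N : ℝ) + 0)) * ih
  · rw [hrCoeffAB_eq_zero_of_not_inDescendantRange a b Δ hr,
      hrCoeff_eq_zero_of_not_inDescendantRange Δ hr]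
    ring

/-- **Dolan–Osborn factorisation of the external-dimension dependence** (their eq. (3.11) at `d = 3`,
in cross-multiplied form valid for every `Δ, ℓ, n, j, a, b`):
`A_{n,j}(a,b) · Π_{00}(n,j) = Π_{ab}(n,j) · A_{n,j}(0,0)`, `Π_{ab} = doPochFactor a b`. Wherever
`Π_{00}(n,j) ≠ 0` — every `Δ` above the unitarity bound except the point `Δ = 1, ℓ = 0` — this says
`A_{n,j}(a,b) = [(λ₁+a)_m(λ₁+b)_m(λ₂-½+a)_{n'}(λ₂-½+b)_{n'} / ((λ₁)_m (λ₂-½)_{n'})²] · A_{n,j}(0,0)`: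
all dependence on `(Δ₁₂, Δ₃₄)` is an explicit polynomial prefactor. Proof: induction on the level; both
arrays obey the same recursion up to the factors `(λ₁+m+a)(λ₁+m+b)/(λ₁+m)²`, resp.
`(λ₂-½+n'+a)(λ₂-½+n'+b)/(λ₂-½+n')²`, absorbed by `Π`. [cite: DolanOsborn2004, §3 eq. (3.11)] -/
theorem hrCoeffAB_mul_doPochFactor (a b Δ : ℝ) (ℓ : ℕ) :
    ∀ n j : ℕ, hrCoeffAB a b Δ ℓ n j * doPochFactor 0 0 Δ ℓ n j =
      doPochFactor a b Δ ℓ n j * hrCoeff Δ ℓ n j := by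
  intro n
  induction n with
  | zero =>
    intro j
    by_cases h : j = ℓ
    · subst h
      simp [doPochFactor_zero_self]
    · rw [hrCoeffAB_zero_of_ne a b Δ h, hrCoeff_zero_of_ne Δ h, zero_mul, mul_zero]
  | succ n ih =>
    intro j
    rw [hrCoeffAB_succ, hrCoeff_succ, div_mul_eq_mul_div, ← mul_div_assoc]
    congr 1
    rw [add_mul, mul_add]
    have hminus := factor_step_minus a b Δ ℓ n j (ih (j + 1))
    rcases Nat.eq_zero_or_pos j with hj | hj
    · subst hj
      simp only [if_true, zero_mul, mul_zero, zero_add]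
      simpa using hminus
    · obtain ⟨j', rfl⟩ : ∃ j', j = j' + 1 := ⟨j - 1, by omega⟩
      have hplus := factor_step_plus a b Δ ℓ n j' (ih j')
      simp only [Nat.add_sub_cancel, Nat.add_eq_zero_iff, one_ne_zero, and_false, if_false]
      rw [hplus, hminus]

/-- `Π_{00}(n,j) = ((λ₁)_m (λ₂-½)_{n'})²` is non-zero as soon as `Δ + ℓ > 0` and `(Δ-ℓ-1)/2` is not a
non-positive integer `> -n'`; in particular for every `Δ` strictly above the unitarity bound with
`Δ ≠ 1` when `ℓ = 0` (for `ℓ ≥ 1` the bound already gives `Δ - ℓ - 1 > 0`). Elementary. [folklore] -/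
theorem doPochFactor_zero_zero_pos {Δ : ℝ} {ℓ : ℕ} (hΔ : unitarityBound3D ℓ < Δ)
    (h1 : ℓ = 0 → Δ ≠ 1) (n j : ℕ) : 0 < doPochFactor 0 0 Δ ℓ n j := by
  have hhalf : 1 / 2 < Δ := one_half_lt_of_unitarityBound3D_lt hΔ
  unfold doPochFactor
  apply mul_pos
  · apply Finset.prod_pos
    intro i _
    have : 0 < (Δ + ℓ) / 2 + (i : ℝ) + 0 := by positivity
    positivity
  · apply Finset.prod_pos
    intro i _
    have hne : (Δ - ℓ - 1) / 2 + (i : ℝ) + 0 ≠ 0 := by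
      rcases Nat.eq_zero_or_pos ℓ with hℓ | hℓ
      · subst hℓ
        have h1' := h1 rfl
        intro h0
        rcases Nat.eq_zero_or_pos i with hi | hi
        · subst hi
          apply h1'
          push_cast at h0
          linarith
        · have : (1 : ℝ) ≤ (i : ℝ) := by exact_mod_cast hi
          push_cast at h0
          linarith
      · have := cast_add_one_lt_of_unitarityBound3D_lt hℓ hΔ
        intro h0
        have : (0 : ℝ) ≤ (i : ℝ) := by positivity
        linarith
    have hsq : ((Δ - ℓ - 1) / 2 + (i : ℝ) + 0) * ((Δ - ℓ - 1) / 2 + (i : ℝ) + 0) =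
        ((Δ - ℓ - 1) / 2 + (i : ℝ) + 0) ^ 2 := by ring
    rw [hsq]
    positivity

/-- **The factorised form**, solved for `A_{n,j}(a,b)` where `Π_{00} ≠ 0`.
[cite: DolanOsborn2004, §3 eq. (3.11)] -/
theorem hrCoeffAB_eq_doPochFactor_div_mul {a b Δ : ℝ} {ℓ n j : ℕ}
    (h : doPochFactor 0 0 Δ ℓ n j ≠ 0) :
    hrCoeffAB a b Δ ℓ n j = doPochFactor a b Δ ℓ n j / doPochFactor 0 0 Δ ℓ n j * hrCoeff Δ ℓ n j := by
  rw [div_mul_eq_mul_div, eq_div_iff h]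
  exact hrCoeffAB_mul_doPochFactor a b Δ ℓ n j

/-! ### The `a = -b` family: geometric-mean structure and domination -/

/-- `Π_{a,-a} · Π_{a,-a} = Π_{a,a} · Π_{-a,-a}`: each factor `(x+a)(x-a)` squared is `(x+a)²(x-a)²`.
[cite: DolanOsborn2004, §3 eq. (3.11)] -/
theorem doPochFactor_neg_mul_self (a Δ : ℝ) (ℓ n j : ℕ) :
    doPochFactor a (-a) Δ ℓ n j * doPochFactor a (-a) Δ ℓ n j =
      doPochFactor a a Δ ℓ n j * doPochFactor (-a) (-a) Δ ℓ n j := by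
  unfold doPochFactor
  rw [mul_mul_mul_comm, ← Finset.prod_mul_distrib, ← Finset.prod_mul_distrib, mul_mul_mul_comm,
    ← Finset.prod_mul_distrib, ← Finset.prod_mul_distrib]
  congr 1
  · exact Finset.prod_congr rfl fun i _ => by ring
  · exact Finset.prod_congr rfl fun i _ => by ring

/-- **Geometric-mean identity for the non-reflection-positive ordering** (`Δ₃₄ = Δ₁₂`, e.g. the family
`gmm = g^{Δ_σε,Δ_σε}` of `⟨σεσε⟩`), cross-multiplied form:
`(A_{n,j}(a,-a) Π_{00})² = (A_{n,j}(a,a) Π_{00}) (A_{n,j}(-a,-a) Π_{00})`. [cite: DolanOsborn2004, §3 eq. (3.11)] -/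
theorem hrCoeffAB_neg_mul_self (a Δ : ℝ) (ℓ n j : ℕ) :
    (hrCoeffAB a (-a) Δ ℓ n j * doPochFactor 0 0 Δ ℓ n j) *
        (hrCoeffAB a (-a) Δ ℓ n j * doPochFactor 0 0 Δ ℓ n j) =
      (hrCoeffAB a a Δ ℓ n j * doPochFactor 0 0 Δ ℓ n j) *
        (hrCoeffAB (-a) (-a) Δ ℓ n j * doPochFactor 0 0 Δ ℓ n j) := by
  rw [hrCoeffAB_mul_doPochFactor, hrCoeffAB_mul_doPochFactor, hrCoeffAB_mul_doPochFactor]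
  have h := doPochFactor_neg_mul_self a Δ ℓ n j
  linear_combination (hrCoeff Δ ℓ n j * hrCoeff Δ ℓ n j) * h

/-- **`A_{n,j}(a,-a)² = A_{n,j}(a,a) · A_{n,j}(-a,-a)`** wherever `Π_{00}(n,j) ≠ 0`: the coefficient of the
mixed ordering is the geometric mean (up to sign) of the two reflection-positive ones.
[cite: DolanOsborn2004, §3 eq. (3.11)] -/
theorem hrCoeffAB_neg_sq {a Δ : ℝ} {ℓ n j : ℕ} (h : doPochFactor 0 0 Δ ℓ n j ≠ 0) :
    hrCoeffAB a (-a) Δ ℓ n j ^ 2 = hrCoeffAB a a Δ ℓ n j * hrCoeffAB (-a) (-a) Δ ℓ n j := by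
  have h2 : doPochFactor 0 0 Δ ℓ n j * doPochFactor 0 0 Δ ℓ n j ≠ 0 := mul_ne_zero h h
  have key := hrCoeffAB_neg_mul_self a Δ ℓ n j
  have : (hrCoeffAB a (-a) Δ ℓ n j ^ 2 - hrCoeffAB a a Δ ℓ n j * hrCoeffAB (-a) (-a) Δ ℓ n j) *
      (doPochFactor 0 0 Δ ℓ n j * doPochFactor 0 0 Δ ℓ n j) = 0 := by
    linear_combination key
  rcases mul_eq_zero.mp this with h0 | h0
  · linarith
  · exact absurd h0 h2

/-- **Termwise domination of the `⟨σεσε⟩`-type coefficients by the reflection-positive ones**: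
strictly above the unitarity bound (and `Δ ≠ 1` if `ℓ = 0`),
`|A_{n,j}(a,-a)| ≤ (A_{n,j}(a,a) + A_{n,j}(-a,-a))/2` (AM–GM on `hrCoeffAB_neg_sq`, both factors being
`≥ 0` by `hrCoeffAB_self_nonneg`) — the coefficient-level Cauchy–Schwarz bound that lets a certificate
enclose the sign-indefinite `a = -b` series by two positive ones. [cite: DolanOsborn2004, §3 eq. (3.11)] -/
theorem abs_hrCoeffAB_neg_le {a Δ : ℝ} {ℓ : ℕ} (hΔ : unitarityBound3D ℓ < Δ) (h1 : ℓ = 0 → Δ ≠ 1)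
    (n j : ℕ) :
    |hrCoeffAB a (-a) Δ ℓ n j| ≤ (hrCoeffAB a a Δ ℓ n j + hrCoeffAB (-a) (-a) Δ ℓ n j) / 2 := by
  have hP := (doPochFactor_zero_zero_pos hΔ h1 n j).ne'
  have hsq := hrCoeffAB_neg_sq (a := a) hP
  have hp := hrCoeffAB_self_nonneg a hΔ n j
  have hm := hrCoeffAB_self_nonneg (-a) hΔ n j
  set x := hrCoeffAB a (-a) Δ ℓ n j
  set p := hrCoeffAB a a Δ ℓ n j
  set q := hrCoeffAB (-a) (-a) Δ ℓ n j
  rw [abs_le]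
  constructor
  · nlinarith [sq_nonneg (p - q), sq_nonneg (x + (p + q) / 2), sq_abs x]
  · nlinarith [sq_nonneg (p - q), sq_nonneg (x - (p + q) / 2)]

end Literature.MathematicalPhysics.QuantumFieldTheory.ConformalBootstrap3D
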